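import Mathlib
import HarnessLib
import HarnessLib.Audit
import Summits.Schanuel.Statement
import HarnessLib.Audit.Status.Attr

/-!
Route: CyclotomicRigidity

DORMANT since 2026-08-22T18:43:40Z (reconciler: no traction for 5.6 d (last activity item-evidence-added at 2026-08-17T04:24:20Z); parked, not closed — `ledger route dormant route-Schanuel-CyclotomicRigidity --off` to reactivate) — unstaffed, not closed; items shared with open routes are served there. `ledger route dormant <id> --off` reactivates.

# Route CyclotomicRigidity — Galois up the kernel-free tower — Schanuel = (free tower) + (strong
tower); χ_cyc ∉ ±1 and Kummer characters keep π and every log α out of ℚ̄(e^ℚ̄(e^…))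

Let E ⊂ ℂ be the KERNEL-FREE TOWER: the smallest subfield of ℂ containing ℚ̄ and closed under exp (E
= ⋃ E_k, E₀ = ℚ̄,
E_{k+1} = E_k(e^w : w ∈ E_k); E₁ = ℚ̄(e^ℚ̄) is the Lindemann–Weierstrass field). It suffices to show
X = TowerSchanuel ∧ TowerStrong:
(TowerSchanuel) Schanuel's conjecture for tuples FROM E — equivalently, every step of the tower is
generic, E is Macintyre's free
E-field on ℚ̄; and (TowerStrong) E is strongly embedded in ℂ — for z₁,…,zₙ ℚ-linearly independent
MODULO E,
trdeg_E E(z, e^z) ≥ n ("whatever is not in the tower, in particular 2πi and every log α, is generic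
over it"). X ⟺ Schanuel
(Assembly + support SchanuelImpliesLocalisation). The card
Schanuel/Schanuel/cyclotomic-rigidity-lw-field is the line of attack on
TowerSchanuel through its GALOIS SHADOW: GalExtTower (every σ ∈ Aut(ℚ̄/ℚ) extends to an
exp-compatible field automorphism of E —
level 1 is a THEOREM by LW, all levels follow from TowerSchanuel by Kirby's free-extension
functoriality), which the cyclotomic
character (χ(σ) ∉ ℤ ∩ ℤ̂ˣ = {±1}) and the Kummer characters (κ_α(σ) ∉ ℤ) convert into transcendence:
π ∉ E, no log of an
algebraic number lies in E (LogFreeTower ∋ "e^e ∉ ℚ̄"), and the first new rung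
"Lindemann–Weierstrass with one coefficient π" (LWWithPi ⟺ π ∉ E₁).
Lean: `(∀ (n : ℕ) (z : Fin n → ℂ), (∀ i, z i ∈ (sInf {K : IntermediateField ℚ ℂ | algebraicClosure ℚ
ℂ ≤ K ∧ ∀ w ∈ K, Complex.exp w ∈ K} : IntermediateField ℚ ℂ)) → LinearIndependent ℚ z → (n :
Cardinal) ≤ Algebra.trdeg ℚ ↥(IntermediateField.adjoin ℚ (Set.range z ∪ Set.range (Complex.exp ∘
z)))) ∧ (∀ (n : ℕ) (z : Fin n → ℂ), (∀ q : Fin n → ℚ, (∑ i, (q i : ℂ) * z i) ∈ (sInf {K :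
IntermediateField ℚ ℂ | algebraicClosure ℚ ℂ ≤ K ∧ ∀ w ∈ K, Complex.exp w ∈ K} : IntermediateField ℚ
ℂ) → q = 0) → (n : Cardinal) ≤ Algebra.trdeg ↥(sInf {K : IntermediateField ℚ ℂ | algebraicClosure ℚ
ℂ ≤ K ∧ ∀ w ∈ K, Complex.exp w ∈ K} : IntermediateField ℚ ℂ) ↥(IntermediateField.adjoin ↥(sInf {K :
IntermediateField ℚ ℂ | algebraicClosure ℚ ℂ ≤ K ∧ ∀ w ∈ K, Complex.exp w ∈ K} : IntermediateField ℚ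
ℂ) (Set.range z ∪ Set.range (Complex.exp ∘ z))))`

## Assembly
Pure field-theoretic bookkeeping (M–L in Lean; the planner checked it on paper, not in the kernel):
given z : Fin n → ℂ ℚ-linearly
independent, let V = span_ℚ(z), m = dim(V ∩ E), and pick a ℚ-basis (c₁,…,c_m, w₁,…,w_r) of V with c
⊂ V ∩ E, so that w is
ℚ-linearly independent modulo E and m + r = n; rescale so that every z_i is a ℤ-combination of (c,
w). Then ℚ(c, w, e^c, e^w) is
algebraic over ℚ(z, e^z) (e^{qz} is algebraic over e^z) and contains it, so the two have equal trdeg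
over ℚ (Algebra.trdeg_add_eq +
trdeg 0 for algebraic extensions); and trdeg ℚ(c,w,e^c,e^w) = trdeg ℚ(c,e^c) + trdeg_{ℚ(c,e^c)}
(w,e^w) ≥ m + trdeg_E E(w,e^w) ≥ m + r
= n, using TowerSchanuel for c (all c_i ∈ E), base change ℚ(c,e^c) ⊆ E (E is exp-closed) which can
only lower the transcendence
degree of the field generated by (w, e^w), and TowerStrong for w. n = 0 and m = 0 / r = 0 are
degenerate but harmless.

Rationale: WHY THIS LINE. Imported area: infinite Galois theory / arithmetic of 𝔾_m (cyclotomic and Kummer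
characters) acting on Kirby–Macintyre free
exponential-field constructions (model theory of exponential fields), pointed at a concrete
countable subfield of ℂ. By
Lindemann–Weierstrass (PROVED in the tree:
`Literature.NumberTheory.Transcendental.LindemannWeierstrass.AlgIndep_holds`) E₁ = ℚ̄(e^ℚ̄)
is the fraction field of the group algebra ℚ̄[(ℚ̄,+)], so every σ ∈ Aut(ℚ̄/ℚ) acts on it by the
wild, exp-compatible automorphism
e^β ↦ e^{σβ}; Kirby2013FPEF Prop 6.11 (arXiv:0912.4019 p.18: "σ extends uniquely to an automorphism
of F^E") is the abstract fact
that FREE exponential steps are functorial, and Macintyre1991 §3 identifies SC-on-the-tower with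
freeness of the constant tower
(lim Frac(R_n[Γ_n])). The new move (card + this route): read automorphism extension BACKWARDS as a
transcendence criterion on
the kernel-free side — if σ with χ_cyc(σ) ∉ {±1} extends up E then 2πi ∉ E
(KirbyMacintyreOnshuus2012 §2.1 run in reverse:
e^{τ(2πi)} = 1 forces σ(ζ_N) = ζ_N^j for one INTEGER j and all N), and if all σ extend then no u ∈
E∖0 has e^u ∈ ℚ̄ (for σ
fixing α = e^u, τ(u) = u + 2πik_σ makes σ act on the Kummer tower (e^{u/N})_N through the integer
k_σ, while the Kummer image
is open in ℤ̂; the Galois-fixed rational tower needs only "a positive rational with rational N-th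
roots for all N is 1", giving
e^e ∉ ℚ̄ from GalExtTower in half a page). What no prior route or negative does: RigidCore's core
C_EA CONTAINS 2πi and studies
∅-definability of ℂ_exp; ExpMordellWeil bounds ranks inside f.g. fields; Zilber transfers from 𝔹;
here the object is the
kernel-FREE closure of ℚ̄, the symmetry is arithmetic (Aut(ℚ̄/ℚ), not Aut(ℂ_exp)), covariance is
strictly weaker than
independence, and the outputs π ∉ E_k, LWWithPi, LogFreeTower are new checkable SC-fragments
strictly between LW and SC
(negatives index: empty). Considered and not used: probabilistic/metric models (no transfer to the
countable field E),
o-minimality (E ⊂ ecl(∅), where E-derivations vanish: barrier AxSchanuelFunctionalNotNumerical),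
motivic Galois groups
(they see the torus of E₁, not the arithmetic Galois action on its character lattice).

RANKED CRUXES. #2 GalExtTower (crux) — (card C2, all levels and all σ at once) every field
automorphism σ of ℚ̄ = algebraicClosure ℚ ℂ extends to a map τ : ℂ → ℂ which is a bijective ring
endomorphism of the tower E, restricts to σ on ℚ̄, and satisfies τ(e^w) = e^{τ(w)} for all w ∈ E.
Level 1 (E₁) is a theorem (support LevelOneGalExt, from LW); TowerSchanuel ⟹ GalExtTower (support
TowerSchanuelImpliesGalExt); GalExtTower ⟹ π ∉ E, LogFreeTower, e^e ∉ ℚ̄ (supports). The mechanism's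
central, strictly-weaker-than-independence claim: relation ideals of exponentials of tower elements
are Galois-COVARIANT. [difficulty: open-problem] (why it might fail: It already forces e^e ∉ ℚ̄ and
π ∉ E (both open) — false iff some hidden algebraic relation among exponentials of tower elements is
not transported by σ, which would refute Schanuel; beyond level 1 (LW) no engine for extending σ
inside ℂ is known.) [Kirby2013FPEF, KirbyMacintyreOnshuus2012, Macintyre1991, BakerTNT1975,
idea:Schanuel/Schanuel/cyclotomic-rigidity-lw-field]
#3 LWWithPi (crux) — (card C1, the first new rung; ⟺ π ∉ E₁ = ℚ̄(e^ℚ̄) by clearing denominators +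
LW) LINDEMANN–WEIERSTRASS WITH ONE COEFFICIENT π: for finite sets s, t of algebraic numbers and
algebraic coefficients a on s, b on t, not all zero, Σ_{x∈s} a_x e^x + π·Σ_{x∈t} b_x e^x ≠ 0.
Bilinear (π × exponentials), hence outside the ℚ̄-linear shadow of SC; its one-term case a·e = b·π
(a, b ∈ ℚ) is the irrationality of π/e. Implied by PiNotInTower (support), hence by LogFreeTower,
GalExtTower, TowerSchanuel, Schanuel. [difficulty: open-problem] (why it might fail: Its simplest
instance (π/e irrational) is open since Hermite; the commensurable-frequency normal form
e^{P(e^{1/N})} ≠ −1 is a depth-2 Hermite–Lindemann at the TRANSCENDENTAL point e^{1/N}, where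
Siegel–Shidlovskii is silent (barrier EFunctionValuesAtAlgebraicPoints).) [BakerTNT1975,
Waldschmidt2004, Lang1966, idea:Schanuel/Schanuel/cyclotomic-rigidity-lw-field]
#4 LogFreeTower (crux) — HERMITE–LINDEMANN ON THE TOWER: if u ∈ E and e^u is algebraic then u = 0;
i.e. E ∩ 𝓛 = {0} for 𝓛 = exp⁻¹(ℚ̄ˣ) — no logarithm of an algebraic number (2πi, log 2, …) is a
rational function of iterated exponentials of algebraic numbers, and e^u ∉ ℚ̄ for every u ∈ E∖0 (u =
e: e^e ∉ ℚ̄; u = e^{√2}+1, …). New rung (this route): it follows from GalExtTower by Kummer theory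
of 𝔾_m (support GalExtImpliesLogFree; the Galois-fixed rational sub-tower needs only divisibility in
ℚ_{>0}: support GalExtImpliesRationalTowerHL) and from TowerSchanuel by predimension; it implies
PiNotInTower and LWWithPi. It states that the kernel-free tower and the toric-period sector 𝓛 of
barrier PeriodConjectureOverQbarScope are DISJOINT. [deps: GalExtTower] [difficulty: open-problem]
(why it might fail: Contains e^e ∉ ℚ̄ and π ∉ E, open at every level ≥ 1 (level 0 is
Hermite–Lindemann); unconditionally no method controls e^u at a transcendental u ∈ E₁ (one point,
one function: below the two-functions ceiling of Schneider–Lang).) [BakerTNT1975, Waldschmidt2004,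
KirbyMacintyreOnshuus2012, arXiv:math/9805045]
#5 TowerSchanuel (crux) — SCHANUEL ON THE KERNEL-FREE TOWER: for z₁,…,zₙ ∈ E linearly independent
over ℚ, trdeg_ℚ ℚ(z, e^z) ≥ n. Equivalently every step E_k → E_{k+1} is generic (the exponentials of
a ℚ-basis of E_k mod E_{k−1} are algebraically independent over E_k), i.e. E ≅ Macintyre's free
E-field on ℚ̄ (Macintyre1991 §3: SC ⇒ the smallest E-subfield of ℝ is lim Frac(R_n[Γ_n]); "no hidden
iterated exponential identities for exponential constants", Richardson's identity problem). Level ≤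
1 is LW (theorem); level 2 contains e ⊥ e^e ⊥ e^{e²}. It implies GalExtTower (support) and, with
TowerStrong, Schanuel (Assembly). [difficulty: open-problem] (why it might fail: Iff Schanuel fails
inside the tower (z = (1, e): e, e^e algebraically independent is already open); the only known
engine on E beyond level 1 is LW itself, and E ⊂ ecl(∅) where E-derivations vanish.) [Macintyre1991,
Richardson1997, Kirby2013FPEF, Lang1966, arXiv:1602.02016]
#6 TowerStrong (crux) — THE TOWER IS STRONG IN ℂ (relative Schanuel over E, Kirby's E ◁ ℂ): if
z₁,…,zₙ ∈ ℂ are ℚ-linearly independent modulo E (no non-trivial rational combination lies in E) then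
trdeg_E E(z₁,…,zₙ,e^{z₁},…,e^{zₙ}) ≥ n. Contains "2πi is transcendental over E" (⊇ e ⊥ π once π ∉ E)
and "log 2, log 3 algebraically independent over E". Implied by Schanuel (support
SchanuelImpliesLocalisation, via δ = 0 on finite towers); the non-Galois half of the localisation,
filed to make the Assembly honest rather than as the line's bet. [difficulty: open-problem] (why it
might fail: Iff Schanuel fails off the tower; z = (log 2, log 3) puts it fully under the
AlgebraicIndependenceOfLogarithms barrier and z = (2πi) contains e ⊥ π — no engine; it is
bookkeeping for honesty, staffed last.) [Kirby2010, Kirby2013FPEF, Waldschmidt2000, Lang1966]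
#9 PiNotInTower (support) — (special case; the card's title) π ∉ E: π is not a rational function,
over ℚ̄, of iterated exponentials of algebraic numbers, at any depth. Implied by LogFreeTower (u =
2πi) and by GalExtTower (support GalExtImpliesPiNotInTower); implies LWWithPi (support
PiNotInTowerImpliesLWWithPi). Level-truncated versions π ∉ E_k are the layer-2 children.
[difficulty: open-problem] [KirbyMacintyreOnshuus2012, arXiv:math/9805045,
idea:Schanuel/Schanuel/cyclotomic-rigidity-lw-field]
#9 GalExtImpliesPiNotInTower (support) — CYCLOTOMIC RIGIDITY (the card's Proposition, all levels at
once; PROVABLE NOW, ~300 lines): GalExtTower → π ∉ E. Proof: if 2πi ∈ E pick σ ∈ Aut(ℚ̄/ℚ) with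
σ(ζ₅) = ζ₅² (AlgEquiv.liftNormal from ℚ(ζ₅)) and its τ; t := τ(2πi) has e^t = τ(1) = 1 so t = 2πij,
j ∈ ℤ (Complex.exp_eq_one_iff); ζ_N = e^{2πi/N} ∈ ℚ̄ gives σ(ζ_N) = τ(e^{2πi/N}) = e^{t/N} = ζ_N^j
for ALL N; N = 5 forces j ≡ 2 (mod 5), so |j| ≥ 2 and a prime p ∣ j gives σ(ζ_p) = ζ_p^j = 1,
contradiction (Complex.isPrimitiveRoot_exp). (χ_cyc(σ) = j ∈ ℤ ∩ ℤ̂ˣ = {±1} in KMO's language.)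
[difficulty: provable-now] [KirbyMacintyreOnshuus2012, Mathlib: Complex.exp_eq_one_iff, Mathlib:
AlgEquiv.liftNormal, Mathlib: Complex.isPrimitiveRoot_exp]
#9 PiNotInTowerImpliesLWWithPi (support) — PROVABLE NOW (~150 lines): PiNotInTower → LWWithPi. If
Σ_s a_x e^x + π Σ_t b_x e^x = 0: when B := Σ_t b_x e^x ≠ 0, π = −(Σ_s a_x e^x)/B ∈ E (E ⊇ ℚ̄ ∋ a_x,
b_x, x and e^x ∈ E); when B = 0 the tree's LW `LindemannWeierstrass.SumForm_holds` forces b ≡ 0 on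
t, then a ≢ 0 on s and Σ_s a_x e^x = 0 contradicts LW again. [difficulty: provable-now]
[BakerTNT1975, tree: Literature.NumberTheory.Transcendental.LindemannWeierstrass.SumForm_holds]
#9 GalExtImpliesRationalTowerHL (support) — PROVABLE NOW (~400 lines; the half-page "e^e is
transcendental from Galois covariance"): GalExtTower → for every u in the RATIONAL tower E_ℚ :=
smallest exp-closed subfield of ℂ (∋ e, e^e, e+e^{e²}, …), e^u algebraic ⇒ u = 0. Proof: E_ℚ ⊆
Fix(τ) for every extension τ (Fix(τ) ∩ E is an exp-closed subfield), so α := e^u and all α_N :=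
e^{u/N} (algebraic, being N-th roots of α) are fixed by every σ ∈ Aut(ℚ̄/ℚ), hence rational; α_N =
α_{2N}² > 0 and α = α_N^N for all N force α = 1 (unique factorisation), so u ∈ 2πiℤ, and u ≠ 0 would
put 2πi ∈ E, excluded by GalExtImpliesPiNotInTower's argument. [difficulty: provable-now]
[KirbyMacintyreOnshuus2012, Macintyre1991, BakerTNT1975]
#9 GalExtImpliesLogFree (support) — KUMMER UPGRADE (provable, L: needs Kummer theory of 𝔾_m over a
number field): GalExtTower → LogFreeTower. For u ∈ E with e^u = α ∈ ℚ̄ˣ not a root of unity and σ ∈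
Aut(ℚ̄/ℚ(α)) with extension τ: e^{τu} = σ(α) = α gives τ(u) = u + 2πik_σ, k_σ ∈ ℤ, and σ(α_N) =
e^{τ(u)/N} = α_N ζ_N^{k_σ} for the compatible roots α_N = e^{u/N}: σ acts on the Kummer tower
ℚ(α^{1/∞}) through the INTEGER k_σ ∈ ℤ ⊂ ℤ̂. But the Kummer character of Gal(ℚ̄/ℚ(α, μ_∞)) on
(α_N)_N has open image in ℤ̂ (α non-torsion in ℚ(α)ˣ: bounded divisibility from a prime 𝔭 with
v_𝔭(α) ≠ 0 or Dirichlet's unit theorem, plus H¹(Gal(ℚ(α,μ_∞)/ℚ(α)), μ_N) bounded), and an open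
subgroup of ℤ̂ is uncountable ⊄ ℤ. Roots of unity α reduce to 2πi ∈ E, i.e. to
GalExtImpliesPiNotInTower. [difficulty: L] [KirbyMacintyreOnshuus2012, Lang1966, Mathlib:
Mathlib.FieldTheory.KummerExtension]
#9 LevelOneGalExt (support) — THE BOTTOM RUNG IS A THEOREM (provable now from the tree's LW
`AlgIndep_holds`, L, ~600 lines): every σ ∈ Aut(ℚ̄/ℚ) extends to a bijective ring endomorphism τ of
the Lindemann–Weierstrass field E₁ = ℚ(ℚ̄ ∪ e^ℚ̄) = ℚ̄(e^β : β ∈ ℚ̄) with τ(a) = σ(a) and τ(e^a) =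
e^{σ(a)} for algebraic a. Route: by LW the ℚ̄-algebra map from the group algebra ℚ̄[(ℚ̄,+)] to ℂ,
[β] ↦ e^β, is injective, so E₁ = Frac ℚ̄[(ℚ̄,+)] and τ is the σ-semilinear automorphism Σ a_β[β] ↦ Σ
σ(a_β)[σβ] passed to fractions (c̃ = complex conjugation; all other τ are discontinuous). Also
yields the Adams endomorphisms ψ^m : e^β ↦ e^{mβ} for later use. [difficulty: L] [BakerTNT1975,
tree: Literature.NumberTheory.Transcendental.LindemannWeierstrass.AlgIndep_holds, Kirby2013FPEF]
#9 SchanuelImpliesLocalisation (support) — CERTIFIES X ⟺ Schanuel (the route is a localisation, not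
a weakening): Schanuel → TowerSchanuel ∧ TowerStrong. First conjunct: instantiate. Second (L): E =
⋃_W ℚ̄(e^W) over finite ℚ-linearly independent tower sequences W = (w₁,…,w_D), w_j ∈
ℚ̄(e^{w₁},…,e^{w_{j−1}}) (union-of-levels description of the sInf); Schanuel on W gives trdeg ℚ(W,
e^W) = D exactly (≥ D by SC, ≤ D since W ⊂ ℚ̄(e^W)); if z is independent mod E with trdeg_E E(z,e^z)
= t < n, choose W carrying the coefficients of the algebraic relations, then Schanuel on (W, z)
gives D + n ≤ trdeg ℚ(W,z,e^W,e^z) ≤ D + t, contradiction. [difficulty: L] [Kirby2010,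
Macintyre1991, arXiv:math/9805045]
#9 TowerSchanuelImpliesGalExt (support) — FREENESS ⟹ FUNCTORIALITY (Kirby2013FPEF Prop 6.11 "σ
extends uniquely to an automorphism of F^E", transplanted into ℂ; provable, L/XL): TowerSchanuel →
GalExtTower. Induct on levels: given τ_k on E_k (exp-compatible on E_{k−1}, mapping E_{k−1} onto
itself), choose a ℚ-complement C_k of E_{k−1} in E_k; TowerSchanuel makes E_{k+1} = Frac(E_k[C_k])
(exponentials of a ℚ-basis of C_k algebraically independent over E_k, coherent roots e^{c/N});
define τ_{k+1} by τ_k on coefficients and [c] ↦ e^{τ_k(c)} — injective because τ_k(C_k) is again a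
complement of E_{k−1}, surjective because e^{τ_k v} = τ_k(e^v) for v ∈ E_{k−1}; take τ = ⋃ τ_k.
[difficulty: XL] [Kirby2013FPEF, Macintyre1991]

TWO-LAYER PLAN. Foreseen glued splits (none filed now; k ≤ 3, depth 1): GalExtTower ⇐
GalExtLevelTwo(σ with χ(σ) ∉ ±1: covariance of E₁-relation
ideals of exponentials of E₁-elements) → GalExtInduction (level k ⇒ k+1 given genericity of the
step) → GalExtTower;
PiNotInTower ⇐ (π ∉ E₁ = LWWithPi) → (π ∉ E₂: "e^{R(e^{1/N})} ≠ −1", the depth-2 Hermite–Lindemann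
normal form on the orbit, with
the Adams/Mahler points e^{m/N}) → PiNotInTower restricted to commensurable frequencies;
LogFreeTower ⇐ rational tower (support,
provable) → Galois-fixed part of E → full E via Kummer; TowerSchanuel ⇐ level 2 (e ⊥ e^e-type) →
induction on levels.
Supports GalExtImpliesPiNotInTower, PiNotInTowerImpliesLWWithPi, GalExtImpliesRationalTowerHL are
the first deliverables (provable now).

KILL CRITERIA. Every crux is a CONSEQUENCE of Schanuel (certified by SchanuelImpliesLocalisation,
TowerSchanuelImpliesGalExt, GalExtImpliesLogFree,
PiNotInTowerImpliesLWWithPi), so a refutation of ANY of them — e.g. one PSLQ relation Σ a_j e^{γ_j}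
+ π Σ b_j e^{δ_j} = 0 certified
algebraically, or a σ that provably does not extend to E₂ — refutes Schanuel and closes every route
on the summit (close
refuted:<Decl>, hand the witness to the negatives index). Route-specific kills: (i) a proof that
GalExtTower ⟺ TowerSchanuel
(covariance no weaker than independence) empties the mechanism ⇒ close superseded by a plain
freeness/EclCore-type route;
(ii) LWWithPi or "π ∉ exp-closure(ℚ̄)" found in print (Terzo 2008 Comm. Algebra
doi:10.1080/00927870701410694 is paywalled,
acq-02382; Lin 1983 / Chow 1999 checked: not there) ⇒ regrade known, keep only the Galois rungs;
(iii) if a refuter shows the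
sInf-defined E degenerates in Lean (it does not on paper: ⊤ is in the set, and ⋃E_k is the infimum)
⇒ restate once with the
union-of-levels definition (definition request expClosure), same decl names.

NOT DECOMPOSED YET. Level-truncated statements (π ∉ E_k, GalExt_k(σ) for a single σ with χ(σ) ∉ ±1,
LW over ℚ̄(π) ⟺ π ∉ E₁^alg) — layer-2 children
once a support lands; the analytic normal form of π ∉ E₂ on commensurable frequencies
(e^{P(e^{1/N})} ≠ −1, Schneider–Lang with the
Mahler-type points w₀^m supplied by the Adams maps ψ^m) — the only place an auxiliary-function
engine could enter, deliberately not
filed until PiNotInTowerImpliesLWWithPi and LevelOneGalExt fix the algebraic frame; the internal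
Liouville/LW-measure property of E₁
(Sert 1999) — a cite fact to request when the analytic child is filed; the abstract E-field lemma
"cyclic kernel ⇒ E-automorphisms
act on μ_∞ by ±1" (KMO §2.1) as a Literature lemma over `Literature.ModelTheory.ExponentialFields` —
nice but not load-bearing here
(E has NO kernel element; the argument is run inside ℂ). Prior-programme inspiration notes not read
(plancard mode).

CHEAPEST FALSIFIER. (a) Computation (card K1, minutes of kit time): PSLQ/LLL at 300 digits on the
2·13 numbers {e^γ, π·e^δ : γ, δ ∈ {0, ±1, ±2, ±1/2, ±i,
±√2, (1±√5)/2}} with coefficient bound 10^8 — any integer relation, once certified with algebraic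
coefficients, refutes LWWithPi and
Schanuel (news); none is the expected certificate "no relation of height ≤ 10^8 in these shapes"
(evidence on LWWithPi). Not run by
the planner (compute-free hub; refuters run it first). (b) Lookup: does Terzo 2008 (acq-02382) or
D'Aquino–Fornasiero–Terzo
arXiv:1602.02016 already state π ∉ ℚ̄^E-closure or the Galois-extension criterion? (c) Logic check,
one page: derive GalExtTower
from LW alone at level 2 for σ = complex conjugation composed with a wild σ' — if covariance at
level 2 turned out PROVABLE for
some σ with χ(σ) ∉ ±1, PiNotInTower restricted to E₁ (= LWWithPi) would follow at once; the planner
expects this to fail exactly at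
the relation ideal of (e^{w}, e^{σ̃w}) for w = R(e^β) transcendental.

NUMBERS. Level 0 = Hermite–Lindemann (1882), level 1 = Lindemann–Weierstrass (1885, tree-proved); ℤ
∩ ℤ̂ˣ = {±1}; the witness automorphism
uses N = 5, j ≡ 2 (mod 5); Kummer: for α ∈ Kˣ non-torsion the image of the Kummer character in ℤ̂
has finite index (open), ℤ is
countable. Items at open: 14 (5 cruxes, 8 supports, 1 assembly). No PSLQ exclusion box recorded yet
for LWWithPi.

DEFINITION REQUESTS. None load-bearing: every statement inlines E as `sInf {K : IntermediateField ℚ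
ℂ | algebraicClosure ℚ ℂ ≤ K ∧ ∀ w ∈ K, Complex.exp w ∈ K}`
(Mathlib-only import cone). Convenience notion to be requested after open: `expClosure (S : Set ℂ) :
IntermediateField ℚ ℂ` (smallest
exp-closed intermediate field containing S) with its union-of-levels induction principle, topic
Literature/NumberTheory/Transcendental,
for the provers of SchanuelImpliesLocalisation / TowerSchanuelImpliesGalExt. Cite fact wanted later:
LW measure of algebraic
independence (Sert 1999) for the analytic child of PiNotInTower.

Novelty: Searches (2026-08-15, this planner): `lit frontier Schanuel --since 2020` (30 rows:
Zilber–Pink/o-minimal/zeta-values; nothing on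
Galois actions on exponential closures); `lit bridges Schanuel --cross any` (30 rows, none
relevant); `lit search --source zbmath
"exponential constants Schanuel free exponential ring pi"` (1: Terzo 2008
doi:10.1080/00927870701410694, paywalled → acq-02382);
`lit search --source zbmath "free exponential field automorphism roots of unity Kummer Schanuel"`
(0); OpenAlex / S2 / arXiv API:
HTTP 429 (rate-limited, not searched); `lit galaxy search --star all "Schanuel's conjecture in
exponential rings"` (pdf 2: DFT TAMS
2018 = arXiv:1602.02016 generic solutions of iterated-exponential equations under SC; DMT Schanuel
Nullstellensatz), `… "exponential
subring of R generated by 1"` (0), `… "What is a closed-form number"` (daemon queue timeout); READ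
this session: arXiv:0912.4019
p.18 Prop 6.11 + p.6 (free E/EA extensions, automorphism extension), arXiv:1101.4224 §1–2.1, §3.5
(cyclic-kernel rigidity;
extension over strong subfields of Zilber fields), Macintyre1991 §0, §3.1 (SC ⇒ smallest E-subfield
of ℝ free, lim Frac(R_n[Γ_n])),
Chow 1999 arXiv:math/9805045 (EL numbers, reduced towers, Lin's theorem, Colthurst's "explicit
non-closed-form number" problem),
Waldschmidt2004 p.4 (e+π irrationality open); plus the card's audited searches (KMO, Bays–Kirby,
zbMATH: LWWithPi not in print).
Nearest prior art found: KirbyMacintyreOnshuus2012 §2.1 (θ(τ) = ±τ in cycl  [refs: 10.1080/00927870701410694, 1602.02016, 0912.4019, 1101.4224, math/9805045, doi:10.1080/00927870701410694, Macintyre1991, Waldschmidt2004, KirbyMacintyreOnshuus2012]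

Barriers (technique_class: automorphism-extension, cyclotomic-kummer, free-tower): - technique_class: automorphism-extension, cyclotomic-kummer, free-tower
- Literature.Barriers.Schanuel.AxiomsDoNotForceSchanuel: respected, not triggered — nothing is
transferred from axioms of abstract exponential fields; the hard input is LW (level 1) and the
arithmetic of Aut(ℚ̄/ℚ) (χ_cyc, Kummer) acting on a concrete countable subfield of ℂ; Bays–Kirby's
𝔹_P (P(ε,τ) = 0) contain the kernel generator τ, whereas every statement here lives on the
kernel-FREE tower, so they are not counter-models of GalExtTower — but they do show GalExtTower
cannot follow from soft properties of E alone (hence crux, not support).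
- Literature.Barriers.Schanuel.SchanuelPropertyNotFirstOrder: not applicable — no first-order
axiomatisation or ultrapower transfer; all statements are about one subfield E ⊂ ℂ.
- Literature.Barriers.Schanuel.AxSchanuelFunctionalNotNumerical: applies and is respected — E ⊂
ecl(∅), where exponential derivations vanish (eDerivation_apply_eq_zero_of_mem_ecl_empty), so no
Ax/derivation argument can prove TowerSchanuel or GalExtTower; the route uses AUTOMORPHISMS
(discrete symmetries supplied by LW), not derivations — the bet is that covariance under Aut(ℚ̄/ℚ)
is provable where independence is not.
- Literature.Barriers.Schanuel.EFunctionValuesAtAlgebraicPoints: applies to the analytic normal form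
of LWWithPi / π ∉ E₂ (value of e^{P(w)} at the transcendental point w = e^{1/N}); not evaded —
recorded as the reason the analytic child needs the Adams/Mahler points or a genu

Novelty grade: new-combination — refuter route-review grade (resting on the planner's documented searches, grounder g13-13/g12-51 verbatim print reads and ≥ 8 refuter paper checks; my own remote searches were throttled: OpenAlex 429, searchd intermittently down — recorded). Nearest prior art: KMO arXiv:1101.4224 §2.1 (cyclic-kernel (refuter refuter-rreview-route-MatrixMultiplicati-95e7b4aa-0, 2026-08-15T14:14:26Z; prior: arxiv:1101.4224, arxiv:0912.4019, Macintyre1991, arxiv:math/9805045, doi:10.1080/00927870701410694, arxiv:1602.02016, BakerTNT1975, Waldschmidt2004)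

History (route lifecycle, newest last):
- 2026-08-22T18:43:40Z · DORMANT — reconciler: no traction for 5.6 d (last activity item-evidence-added at 2026-08-17T04:24:20Z); parked, not closed — `ledger route dormant route-Schanuel-Cycloto (operator:999:1128570)

sub-problem: Schanuel · status: dormant · opened planner-plancard-Schanuel-Schanuel-cyclotomic-dccec8d5-0 2026-08-15T11:43:48Z · rev 1 · ledger route-Schanuel-CyclotomicRigidity
GENERATED by the gate from the ledger (D-0016/17). Provers cite these decls: `theorem foo : Summit.Schanuel.Schanuel.Theses.CyclotomicRigidity.<Decl> := …` in Summits/Schanuel/Schanuel/Theorems/<Name>.lean.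
-/

namespace Summit.Schanuel.Schanuel.Theses.CyclotomicRigidity

open scoped BigOperators Topology Manifold Classical MeasureTheory ProbabilityTheory Matrix InnerProductSpace ComplexConjugate ContinuousMap
open Filter Set Function TopologicalSpace MeasureTheory

attribute [summit_statement] _root_.Schanuel

open Literature.Periods

/-- item stmt-Schanuel-5985 · crux · rank 2 · open · by planner
why it might fail: It already forces e^e ∉ ℚ̄ and π ∉ E (both open) — false iff some hidden algebraic relation among exponentials of tower elements is not transported by σ, which would refute Schanuel; beyond level 1 (LW) no engine for extending σ inside ℂ is known.
sources: Kirby2013FPEF, KirbyMacintyreOnshuus2012, Macintyre1991, BakerTNT1975, idea:Schanuel/Schanuel/cyclotomic-rigidity-lw-field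
[crux] (card C2, all levels and all σ at once) every field automorphism σ of ℚ̄ = algebraicClosure ℚ
ℂ extends to a map τ : ℂ → ℂ which is a bijective ring endomorphism of the tower E, restricts to σ
on ℚ̄, and satisfies τ(e^w) = e^{τ(w)} for all w ∈ E. Level 1 (E₁) is a theorem (support
LevelOneGalExt, from LW); TowerSchanuel ⟹ GalExtTower (support TowerSchanuelImpliesGalExt);
GalExtTower ⟹ π ∉ E, LogFreeTower, e^e ∉ ℚ̄ (supports). The mechanism's central,
strictly-weaker-than-independence claim: relation ideals of exponentials of tower elements are
Galois-COVARIANT. [difficulty: open-problem] -/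
@[route_item "route-Schanuel-CyclotomicRigidity"]
def GalExtTower : Prop :=
  ∀ σ : ↥(algebraicClosure ℚ ℂ) ≃ₐ[ℚ] ↥(algebraicClosure ℚ ℂ), ∃ τ : ℂ → ℂ, Set.BijOn τ ↑(sInf {K : IntermediateField ℚ ℂ | algebraicClosure ℚ ℂ ≤ K ∧ ∀ w ∈ K, Complex.exp w ∈ K} : IntermediateField ℚ ℂ) ↑(sInf {K : IntermediateField ℚ ℂ | algebraicClosure ℚ ℂ ≤ K ∧ ∀ w ∈ K, Complex.exp w ∈ K} : IntermediateField ℚ ℂ) ∧ (∀ x ∈ (sInf {K : IntermediateField ℚ ℂ | algebraicClosure ℚ ℂ ≤ K ∧ ∀ w ∈ K, Complex.exp w ∈ K} : IntermediateField ℚ ℂ), ∀ y ∈ (sInf {K : IntermediateField ℚ ℂ | algebraicClosure ℚ ℂ ≤ K ∧ ∀ w ∈ K, Complex.exp w ∈ K} : IntermediateField ℚ ℂ), τ (x + y) = τ x + τ y ∧ τ (x * y) = τ x * τ y) ∧ (∀ a : ↥(algebraicClosure ℚ ℂ), τ a = σ a) ∧ ∀ w ∈ (sInf {K : IntermediateField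 ℚ ℂ | algebraicClosure ℚ ℂ ≤ K ∧ ∀ w ∈ K, Complex.exp w ∈ K} : IntermediateField ℚ ℂ), τ (Complex.exp w) = Complex.exp (τ w)

/-- item stmt-Schanuel-5986 · crux · rank 3 · open · by planner
why it might fail: Its simplest instance (π/e irrational) is open since Hermite; the commensurable-frequency normal form e^{P(e^{1/N})} ≠ −1 is a depth-2 Hermite–Lindemann at the TRANSCENDENTAL point e^{1/N}, where Siegel–Shidlovskii is silent (barrier EFunctionValuesAtAlgebraicPoints).
sources: BakerTNT1975, Waldschmidt2004, Lang1966, idea:Schanuel/Schanuel/cyclotomic-rigidity-lw-field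
[crux] (card C1, the first new rung; ⟺ π ∉ E₁ = ℚ̄(e^ℚ̄) by clearing denominators + LW)
LINDEMANN–WEIERSTRASS WITH ONE COEFFICIENT π: for finite sets s, t of algebraic numbers and
algebraic coefficients a on s, b on t, not all zero, Σ_{x∈s} a_x e^x + π·Σ_{x∈t} b_x e^x ≠ 0.
Bilinear (π × exponentials), hence outside the ℚ̄-linear shadow of SC; its one-term case a·e = b·π
(a, b ∈ ℚ) is the irrationality of π/e. Implied by PiNotInTower (support), hence by LogFreeTower,
GalExtTower, TowerSchanuel, Schanuel. [difficulty: open-problem] -/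
@[route_item "route-Schanuel-CyclotomicRigidity"]
def LWWithPi : Prop :=
  ∀ (s t : Finset ℂ) (a b : ℂ → ℂ), (∀ x ∈ s, IsAlgebraic ℚ x) → (∀ x ∈ t, IsAlgebraic ℚ x) → (∀ x ∈ s, IsAlgebraic ℚ (a x)) → (∀ x ∈ t, IsAlgebraic ℚ (b x)) → ((∃ x ∈ s, a x ≠ 0) ∨ ∃ x ∈ t, b x ≠ 0) → (∑ x ∈ s, a x * Complex.exp x) + (Real.pi : ℂ) * (∑ x ∈ t, b x * Complex.exp x) ≠ 0

/-- item stmt-Schanuel-5987 · crux · rank 4 · open · by planner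
why it might fail: Contains e^e ∉ ℚ̄ and π ∉ E, open at every level ≥ 1 (level 0 is Hermite–Lindemann); unconditionally no method controls e^u at a transcendental u ∈ E₁ (one point, one function: below the two-functions ceiling of Schneider–Lang).
sources: BakerTNT1975, Waldschmidt2004, KirbyMacintyreOnshuus2012, arXiv:math/9805045
[crux] HERMITE–LINDEMANN ON THE TOWER: if u ∈ E and e^u is algebraic then u = 0; i.e. E ∩ 𝓛 = {0}
for 𝓛 = exp⁻¹(ℚ̄ˣ) — no logarithm of an algebraic number (2πi, log 2, …) is a rational function of
iterated exponentials of algebraic numbers, and e^u ∉ ℚ̄ for every u ∈ E∖0 (u = e: e^e ∉ ℚ̄; u =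
e^{√2}+1, …). New rung (this route): it follows from GalExtTower by Kummer theory of 𝔾_m (support
GalExtImpliesLogFree; the Galois-fixed rational sub-tower needs only divisibility in ℚ_{>0}: support
GalExtImpliesRationalTowerHL) and from TowerSchanuel by predimension; it implies PiNotInTower and
LWWithPi. It states that the kernel-free tower and the toric-period sector 𝓛 of barrier
PeriodConjectureOverQbarScope are DISJOINT. [deps: GalExtTower] [difficulty: open-problem] -/
@[route_item "route-Schanuel-CyclotomicRigidity"]
def LogFreeTower : Prop :=
  ∀ u ∈ (sInf {K : IntermediateField ℚ ℂ | algebraicClosure ℚ ℂ ≤ K ∧ ∀ w ∈ K, Complex.exp w ∈ K} : IntermediateField ℚ ℂ), IsAlgebraic ℚ (Complex.exp u) → u = 0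

/-- item stmt-Schanuel-5988 · crux · rank 5 · open · by planner
why it might fail: Iff Schanuel fails inside the tower (z = (1, e): e, e^e algebraically independent is already open); the only known engine on E beyond level 1 is LW itself, and E ⊂ ecl(∅) where E-derivations vanish.
sources: Macintyre1991, Richardson1997, Kirby2013FPEF, Lang1966, arXiv:1602.02016
[crux] SCHANUEL ON THE KERNEL-FREE TOWER: for z₁,…,zₙ ∈ E linearly independent over ℚ, trdeg_ℚ ℚ(z,
e^z) ≥ n. Equivalently every step E_k → E_{k+1} is generic (the exponentials of a ℚ-basis of E_k mod
E_{k−1} are algebraically independent over E_k), i.e. E ≅ Macintyre's free E-field on ℚ̄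
(Macintyre1991 §3: SC ⇒ the smallest E-subfield of ℝ is lim Frac(R_n[Γ_n]); "no hidden iterated
exponential identities for exponential constants", Richardson's identity problem). Level ≤ 1 is LW
(theorem); level 2 contains e ⊥ e^e ⊥ e^{e²}. It implies GalExtTower (support) and, with
TowerStrong, Schanuel (Assembly). [difficulty: open-problem] -/
@[route_item "route-Schanuel-CyclotomicRigidity", crux]
def TowerSchanuel : Prop :=
  ∀ (n : ℕ) (z : Fin n → ℂ), (∀ i, z i ∈ (sInf {K : IntermediateField ℚ ℂ | algebraicClosure ℚ ℂ ≤ K ∧ ∀ w ∈ K, Complex.exp w ∈ K} : IntermediateField ℚ ℂ)) → LinearIndependent ℚ z → (n : Cardinal) ≤ Algebra.trdeg ℚ ↥(IntermediateField.adjoin ℚ (Set.range z ∪ Set.range (Complex.exp ∘ z)))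

/-- item stmt-Schanuel-5989 · crux · rank 6 · open · by planner
why it might fail: Iff Schanuel fails off the tower; z = (log 2, log 3) puts it fully under the AlgebraicIndependenceOfLogarithms barrier and z = (2πi) contains e ⊥ π — no engine; it is bookkeeping for honesty, staffed last.
sources: Kirby2010, Kirby2013FPEF, Waldschmidt2000, Lang1966
[crux] THE TOWER IS STRONG IN ℂ (relative Schanuel over E, Kirby's E ◁ ℂ): if z₁,…,zₙ ∈ ℂ are
ℚ-linearly independent modulo E (no non-trivial rational combination lies in E) then trdeg_E
E(z₁,…,zₙ,e^{z₁},…,e^{zₙ}) ≥ n. Contains "2πi is transcendental over E" (⊇ e ⊥ π once π ∉ E) and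
"log 2, log 3 algebraically independent over E". Implied by Schanuel (support
SchanuelImpliesLocalisation, via δ = 0 on finite towers); the non-Galois half of the localisation,
filed to make the Assembly honest rather than as the line's bet. [difficulty: open-problem] -/
@[route_item "route-Schanuel-CyclotomicRigidity", crux]
def TowerStrong : Prop :=
  ∀ (n : ℕ) (z : Fin n → ℂ), (∀ q : Fin n → ℚ, (∑ i, (q i : ℂ) * z i) ∈ (sInf {K : IntermediateField ℚ ℂ | algebraicClosure ℚ ℂ ≤ K ∧ ∀ w ∈ K, Complex.exp w ∈ K} : IntermediateField ℚ ℂ) → q = 0) → (n : Cardinal) ≤ Algebra.trdeg ↥(sInf {K : IntermediateField ℚ ℂ | algebraicClosure ℚ ℂ ≤ K ∧ ∀ w ∈ K, Complex.exp w ∈ K} : IntermediateField ℚ ℂ) ↥(IntermediateField.adjoin ↥(sInf {K : IntermediateField ℚ ℂ | algebraicClosure ℚ ℂ ≤ K ∧ ∀ w ∈ K, Complex.exp w ∈ K} : IntermediateField ℚ ℂ) (Set.range z ∪ Set.range (Complex.exp ∘ z)))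

/-- item stmt-Schanuel-5990 · support · rank 9 · open · by planner
sources: KirbyMacintyreOnshuus2012, arXiv:math/9805045, idea:Schanuel/Schanuel/cyclotomic-rigidity-lw-field
[support] (special case; the card's title) π ∉ E: π is not a rational function, over ℚ̄, of iterated
exponentials of algebraic numbers, at any depth. Implied by LogFreeTower (u = 2πi) and by
GalExtTower (support GalExtImpliesPiNotInTower); implies LWWithPi (support
PiNotInTowerImpliesLWWithPi). Level-truncated versions π ∉ E_k are the layer-2 children.
[difficulty: open-problem] -/
@[route_item "route-Schanuel-CyclotomicRigidity"]
def PiNotInTower : Prop :=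
  (Real.pi : ℂ) ∉ (sInf {K : IntermediateField ℚ ℂ | algebraicClosure ℚ ℂ ≤ K ∧ ∀ w ∈ K, Complex.exp w ∈ K} : IntermediateField ℚ ℂ)

/-- item stmt-Schanuel-5991 · support · rank 9 · open · by planner
sources: KirbyMacintyreOnshuus2012, Mathlib: Complex.exp_eq_one_iff, Mathlib: AlgEquiv.liftNormal, Mathlib: Complex.isPrimitiveRoot_exp
[support] CYCLOTOMIC RIGIDITY (the card's Proposition, all levels at once; PROVABLE NOW, ~300
lines): GalExtTower → π ∉ E. Proof: if 2πi ∈ E pick σ ∈ Aut(ℚ̄/ℚ) with σ(ζ₅) = ζ₅²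
(AlgEquiv.liftNormal from ℚ(ζ₅)) and its τ; t := τ(2πi) has e^t = τ(1) = 1 so t = 2πij, j ∈ ℤ
(Complex.exp_eq_one_iff); ζ_N = e^{2πi/N} ∈ ℚ̄ gives σ(ζ_N) = τ(e^{2πi/N}) = e^{t/N} = ζ_N^j for ALL
N; N = 5 forces j ≡ 2 (mod 5), so |j| ≥ 2 and a prime p ∣ j gives σ(ζ_p) = ζ_p^j = 1, contradiction
(Complex.isPrimitiveRoot_exp). (χ_cyc(σ) = j ∈ ℤ ∩ ℤ̂ˣ = {±1} in KMO's language.) [difficulty: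
provable-now] -/
@[route_item "route-Schanuel-CyclotomicRigidity"]
def GalExtImpliesPiNotInTower : Prop :=
  GalExtTower → PiNotInTower

/-- item stmt-Schanuel-5992 · support · rank 9 · open · by planner
sources: BakerTNT1975, tree: Literature.NumberTheory.Transcendental.LindemannWeierstrass.SumForm_holds
[support] PROVABLE NOW (~150 lines): PiNotInTower → LWWithPi. If Σ_s a_x e^x + π Σ_t b_x e^x = 0:
when B := Σ_t b_x e^x ≠ 0, π = −(Σ_s a_x e^x)/B ∈ E (E ⊇ ℚ̄ ∋ a_x, b_x, x and e^x ∈ E); when B = 0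
the tree's LW `LindemannWeierstrass.SumForm_holds` forces b ≡ 0 on t, then a ≢ 0 on s and Σ_s a_x
e^x = 0 contradicts LW again. [difficulty: provable-now] -/
@[route_item "route-Schanuel-CyclotomicRigidity"]
def PiNotInTowerImpliesLWWithPi : Prop :=
  PiNotInTower → LWWithPi

/-- item stmt-Schanuel-5993 · support · rank 9 · open · by planner
sources: KirbyMacintyreOnshuus2012, Macintyre1991, BakerTNT1975
[support] PROVABLE NOW (~400 lines; the half-page "e^e is transcendental from Galois covariance"):
GalExtTower → for every u in the RATIONAL tower E_ℚ := smallest exp-closed subfield of ℂ (∋ e, e^e,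
e+e^{e²}, …), e^u algebraic ⇒ u = 0. Proof: E_ℚ ⊆ Fix(τ) for every extension τ (Fix(τ) ∩ E is an
exp-closed subfield), so α := e^u and all α_N := e^{u/N} (algebraic, being N-th roots of α) are
fixed by every σ ∈ Aut(ℚ̄/ℚ), hence rational; α_N = α_{2N}² > 0 and α = α_N^N for all N force α = 1
(unique factorisation), so u ∈ 2πiℤ, and u ≠ 0 would put 2πi ∈ E, excluded by
GalExtImpliesPiNotInTower's argument. [difficulty: provable-now] -/
@[route_item "route-Schanuel-CyclotomicRigidity"]
def GalExtImpliesRationalTowerHL : Prop :=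
  GalExtTower → ∀ u ∈ (sInf {K : IntermediateField ℚ ℂ | ∀ w ∈ K, Complex.exp w ∈ K} : IntermediateField ℚ ℂ), IsAlgebraic ℚ (Complex.exp u) → u = 0

/-- item stmt-Schanuel-5994 · support · rank 9 · open · by planner
sources: KirbyMacintyreOnshuus2012, Lang1966, Mathlib: Mathlib.FieldTheory.KummerExtension
[support] KUMMER UPGRADE (provable, L: needs Kummer theory of 𝔾_m over a number field): GalExtTower
→ LogFreeTower. For u ∈ E with e^u = α ∈ ℚ̄ˣ not a root of unity and σ ∈ Aut(ℚ̄/ℚ(α)) with extension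
τ: e^{τu} = σ(α) = α gives τ(u) = u + 2πik_σ, k_σ ∈ ℤ, and σ(α_N) = e^{τ(u)/N} = α_N ζ_N^{k_σ} for
the compatible roots α_N = e^{u/N}: σ acts on the Kummer tower ℚ(α^{1/∞}) through the INTEGER k_σ ∈
ℤ ⊂ ℤ̂. But the Kummer character of Gal(ℚ̄/ℚ(α, μ_∞)) on (α_N)_N has open image in ℤ̂ (α non-torsion
in ℚ(α)ˣ: bounded divisibility from a prime 𝔭 with v_𝔭(α) ≠ 0 or Dirichlet's unit theorem, plus
H¹(Gal(ℚ(α,μ_∞)/ℚ(α)), μ_N) bounded), and an open subgroup of ℤ̂ is uncountable ⊄ ℤ. Roots of unity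
α reduce to 2πi ∈ E, i.e. to GalExtImpliesPiNotInTower. [difficulty: L] -/
@[route_item "route-Schanuel-CyclotomicRigidity"]
def GalExtImpliesLogFree : Prop :=
  GalExtTower → LogFreeTower

/-- item stmt-Schanuel-5995 · support · rank 9 · open · by planner
sources: BakerTNT1975, tree: Literature.NumberTheory.Transcendental.LindemannWeierstrass.AlgIndep_holds, Kirby2013FPEF
[support] THE BOTTOM RUNG IS A THEOREM (provable now from the tree's LW `AlgIndep_holds`, L, ~600
lines): every σ ∈ Aut(ℚ̄/ℚ) extends to a bijective ring endomorphism τ of the Lindemann–Weierstrass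
field E₁ = ℚ(ℚ̄ ∪ e^ℚ̄) = ℚ̄(e^β : β ∈ ℚ̄) with τ(a) = σ(a) and τ(e^a) = e^{σ(a)} for algebraic a.
Route: by LW the ℚ̄-algebra map from the group algebra ℚ̄[(ℚ̄,+)] to ℂ, [β] ↦ e^β, is injective, so
E₁ = Frac ℚ̄[(ℚ̄,+)] and τ is the σ-semilinear automorphism Σ a_β[β] ↦ Σ σ(a_β)[σβ] passed to
fractions (c̃ = complex conjugation; all other τ are discontinuous). Also yields the Adams
endomorphisms ψ^m : e^β ↦ e^{mβ} for later use. [difficulty: L] -/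
@[route_item "route-Schanuel-CyclotomicRigidity"]
def LevelOneGalExt : Prop :=
  ∀ σ : ↥(algebraicClosure ℚ ℂ) ≃ₐ[ℚ] ↥(algebraicClosure ℚ ℂ), ∃ τ : ℂ → ℂ, Set.BijOn τ ↑(IntermediateField.adjoin ℚ ((algebraicClosure ℚ ℂ : Set ℂ) ∪ Complex.exp '' (algebraicClosure ℚ ℂ : Set ℂ))) ↑(IntermediateField.adjoin ℚ ((algebraicClosure ℚ ℂ : Set ℂ) ∪ Complex.exp '' (algebraicClosure ℚ ℂ : Set ℂ))) ∧ (∀ x ∈ IntermediateField.adjoin ℚ ((algebraicClosure ℚ ℂ : Set ℂ) ∪ Complex.exp '' (algebraicClosure ℚ ℂ : Set ℂ)), ∀ y ∈ IntermediateField.adjoin ℚ ((algebraicClosure ℚ ℂ : Set ℂ) ∪ Complex.exp '' (algebraicClosure ℚ ℂ : Set ℂ)), τ (x + y) = τ x + τ y ∧ τ (x * y) = τ x * τ y) ∧ (∀ a : ↥(algebraicClosure ℚ ℂ), τ a = σ a ∧ τ (Complex.exp a) = Complex.exp (σ a))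

/-- item stmt-Schanuel-5996 · support · rank 9 · open · by planner
sources: Kirby2010, Macintyre1991, arXiv:math/9805045
[support] CERTIFIES X ⟺ Schanuel (the route is a localisation, not a weakening): Schanuel →
TowerSchanuel ∧ TowerStrong. First conjunct: instantiate. Second (L): E = ⋃_W ℚ̄(e^W) over finite
ℚ-linearly independent tower sequences W = (w₁,…,w_D), w_j ∈ ℚ̄(e^{w₁},…,e^{w_{j−1}})
(union-of-levels description of the sInf); Schanuel on W gives trdeg ℚ(W, e^W) = D exactly (≥ D by
SC, ≤ D since W ⊂ ℚ̄(e^W)); if z is independent mod E with trdeg_E E(z,e^z) = t < n, choose W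
carrying the coefficients of the algebraic relations, then Schanuel on (W, z) gives D + n ≤ trdeg
ℚ(W,z,e^W,e^z) ≤ D + t, contradiction. [difficulty: L] -/
@[route_item "route-Schanuel-CyclotomicRigidity"]
def SchanuelImpliesLocalisation : Prop :=
  Schanuel → TowerSchanuel ∧ TowerStrong

/-- item stmt-Schanuel-5997 · support · rank 9 · open · by planner
sources: Kirby2013FPEF, Macintyre1991
[support] FREENESS ⟹ FUNCTORIALITY (Kirby2013FPEF Prop 6.11 "σ extends uniquely to an automorphism
of F^E", transplanted into ℂ; provable, L/XL): TowerSchanuel → GalExtTower. Induct on levels: given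
τ_k on E_k (exp-compatible on E_{k−1}, mapping E_{k−1} onto itself), choose a ℚ-complement C_k of
E_{k−1} in E_k; TowerSchanuel makes E_{k+1} = Frac(E_k[C_k]) (exponentials of a ℚ-basis of C_k
algebraically independent over E_k, coherent roots e^{c/N}); define τ_{k+1} by τ_k on coefficients
and [c] ↦ e^{τ_k(c)} — injective because τ_k(C_k) is again a complement of E_{k−1}, surjective
because e^{τ_k v} = τ_k(e^v) for v ∈ E_{k−1}; take τ = ⋃ τ_k. [difficulty: XL] -/
@[route_item "route-Schanuel-CyclotomicRigidity"]
def TowerSchanuelImpliesGalExt : Prop :=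
  TowerSchanuel → GalExtTower

/-- item stmt-Schanuel-5998 · assembly · rank 1 · open · by planner
sources: Waldschmidt2000, Kirby2010, Mathlib: Algebra.trdeg_add_eq
[assembly] TowerSchanuel → TowerStrong → Schanuel (split span_ℚ z along E; tower law for trdeg;
TowerSchanuel on the E-part, TowerStrong on the complement). -/
@[route_item "route-Schanuel-CyclotomicRigidity", crux]
def Assembly : Prop :=
  TowerSchanuel → TowerStrong → Schanuel

/-! D-0027 §2.1 — DECIDING THEOREM (planner-authored via `route open/edit --closes-file`; by planner-rbadge-Schanuel-CyclotomicRigidity-539d6268-g2-0 2026-08-15T16:16:01Z):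
its hypotheses are this route's items and its conclusion the sub-problem Statement (glue_lint), and it elaborates with this file. -/

/-- D-0027 §2.1 deciding theorem of route CyclotomicRigidity. Hypotheses = the three items that are load-bearing for
the DECISION: the two localisation halves `TowerSchanuel` (Schanuel for tuples from the kernel-free tower E, crux #5)
and `TowerStrong` (Schanuel relative to E for tuples ℚ-independent modulo E, crux #6), and the bookkeeping item
`Assembly : TowerSchanuel → TowerStrong → Schanuel` (split span_ℚ z along E, tower law for trdeg; a statement item
provers close like any other). Conclusion = the sub-problem Statement `Schanuel` by name. The remaining items
(GalExtTower, LWWithPi, LogFreeTower, PiNotInTower and the `…Implies…` supports) are the Galois line of attack on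
`TowerSchanuel` and its certified rungs; `SchanuelImpliesLocalisation` certifies X ⟺ Schanuel. None of them is a
premise of the decision, so none is listed here (hypotheses ⊆ items, nothing weakened, no extra hypothesis). -/
@[closes "route-Schanuel-CyclotomicRigidity"] theorem closes (hAssembly : Assembly) (hTower : TowerSchanuel) (hStrong : TowerStrong) : _root_.Schanuel :=
  hAssembly hTower hStrong

end Summit.Schanuel.Schanuel.Theses.CyclotomicRigidity
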